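import Summits.Ventures.HSemireg.WedgeHankelRecurrenceGaussZerosPerturbationFull

/-!
# Venture HSemireg — **GERSHGORIN'S THEOREM FOR THE RECURRENCE (union of intervals)**: if `0 ≤ b_j ≤ c_j²` with `c_j > 0`, every zero `ξ` of `q_{t+1}` lies in one of the intervals
# `|ξ − a_i| ≤ c_i + c_{i+1}` (`i ≤ t`; the term `c_i` is absent for `i = 0` and the term `c_{i+1}` for `i = t`) — the Gershgorin discs of the symmetrised Jacobi matrix `tridiag(c, a, c)`;
# N329 gave only the hull `min(a_i − c_i − c_{i+1}) ≤ ξ ≤ max(a_i + c_i + c_{i+1})`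

HONEST FRAMING. Part of the Lean index of the computation cell `pub-hsemireg` (seat p10 gen 45, Sunday typer «UNIFORM-IN-n»).  Finite products and one evaluation of the recurrence only; no variety,
no cohomology theory, no sheaf, no Ext group and no semiregularity map is constructed here; nothing here says that HC / HC_CM / HC_AV holds; no Literature fact (unproved `Prop`) is declared or used.
Custodian versions as in `WedgeHankelSiegelIdeal` (1/3).
SOURCES (cited).  S. Gerschgorin, *Über die Abgrenzung der Eigenwerte einer Matrix*, Izv. Akad. Nauk SSSR 7 (1931) 749–754; R. A. Horn, C. R. Johnson, *Matrix Analysis* (2nd ed.) Thm 6.1.1;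
M. E. H. Ismail, *Classical and Quantum Orthogonal Polynomials* (2005) §7.2 (bounds for zeros via chain sequences ∕ Gershgorin); E. A. van Doorn, J. Approx. Theory 51 (1987) 254–266.
PROOF TYPED HERE (no matrices).  With `C_n = c_1⋯c_n` and `r_n = q_n(ξ)∕C_n`, pick `i` maximising `|r_i|` over `i ≤ t` (`|r_0| = 1`, so `r_i ≠ 0`); the recurrence at `ξ` reads
`(ξ − a_i) q_i(ξ) = q_{i+1}(ξ) + b_i q_{i−1}(ξ)`; dividing by `C_i |r_i|` and using `|r_{i±1}| ≤ |r_i|`, `b_i ≤ c_i²`, `q_{t+1}(ξ) = 0` gives `|ξ − a_i| ≤ c_{i+1} + c_i` with the stated edge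
conventions.
DEDUP DISCLOSURE (`rg -n 'gershgorin' Summits/Ventures/HSemireg`, 2026-09-03): N329 `zeros_le_gershgorin` ∕ `gershgorin_le_zeros` (hull of the discs, via sign patterns); the union-of-discs statement is
new.  The 2 names below: 0 hits tree-wide.

WHAT IS IN THE TREE.  N325 `prod_Ico_one_succ_succ`; Mathlib `Finset.exists_max_image`.
THIS FILE (namespace `Summit.Ventures.HSemireg.Wedge.HankelOuter` continued; CHAINED on N354 (import only); 0 definitions):
* §1120 **`zero_mem_gershgorin_union`** (`∃ i ≤ t, |ξ − a_i| ≤ [1 ≤ i] c_i + [i + 1 ≤ t] c_{i+1}`), `zero_mem_gershgorin_union'` (the cruder `∃ i ≤ t, |ξ − a_i| ≤ c_i + c_{i+1}`).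
CAVEATS.  Any real zero `ξ` of `q_{t+1}` (no positivity of `b` beyond `0 ≤ b_j ≤ c_j²`); the symmetrised radii `c_i + c_{i+1}` (not `1 + b_{i+1}` of the monic companion form).  Nothing Ext-side.
New names only.
-/

open Module Polynomial
open scoped Matrix Polynomial

namespace Summit.Ventures.HSemireg.Wedge.HankelOuter

/-! ## §1120. Gershgorin's discs for the recurrence -/

/-- **GERSHGORIN'S THEOREM FOR `q_{t+1}`: every zero `ξ` satisfies `|ξ − a_i| ≤ [1 ≤ i]·c_i + [i+1 ≤ t]·c_{i+1}` for some `i ≤ t`** (`0 ≤ b_j ≤ c_j²`, `c_j > 0`).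
[Gerschgorin 1931; Horn–Johnson Thm 6.1.1; this file, §1120] -/
theorem zero_mem_gershgorin_union {q : ℕ → ℝ[X]} {a b : ℕ → ℝ} (hq0 : q 0 = 1) (hq1 : q 1 = Polynomial.X - C (a 0))
    (hrec : ∀ n, q (n + 2) = (Polynomial.X - C (a (n + 1))) * q (n + 1) - C (b (n + 1)) * q n) (hb : ∀ j, 0 ≤ b j)
    {c : ℕ → ℝ} (hc : ∀ j, 0 < c j) (hbc : ∀ j, b j ≤ c j ^ 2) (t : ℕ) {ξ : ℝ} (hξ : (q (t + 1)).eval ξ = 0) :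
    ∃ i, i ≤ t ∧ |ξ - a i| ≤ (if 1 ≤ i then c i else 0) + (if i + 1 ≤ t then c (i + 1) else 0) := by
  classical
  -- the scaling `C_n = c_1⋯c_n` and the scaled values `r_n = q_n(ξ)/C_n`
  obtain ⟨Cn, hCn⟩ : ∃ Cn : ℕ → ℝ, Cn = fun n => ∏ l ∈ Finset.Ico 1 (n + 1), c l := ⟨_, rfl⟩
  have hCpos : ∀ n, 0 < Cn n := fun n => by rw [hCn]; exact Finset.prod_pos fun l _ => hc l
  have hC0 : Cn 0 = 1 := by rw [hCn]; simp
  have hCsucc : ∀ n, Cn (n + 1) = Cn n * c (n + 1) := fun n => by rw [hCn]; exact prod_Ico_one_succ_succ c n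
  obtain ⟨r, hr⟩ : ∃ r : ℕ → ℝ, r = fun n => (q n).eval ξ / Cn n := ⟨_, rfl⟩
  have hqr : ∀ n, (q n).eval ξ = r n * Cn n := fun n => by rw [hr, div_mul_cancel₀ _ (hCpos n).ne']
  have habs : ∀ n, |(q n).eval ξ| = |r n| * Cn n := fun n => by rw [hqr, abs_mul, abs_of_pos (hCpos n)]
  have hr0 : r 0 = 1 := by rw [hr]; simp [hq0, hC0]
  -- a maximiser of `|r_n|`, `n ≤ t`
  obtain ⟨i₀, hi₀, hmax⟩ := Finset.exists_max_image (Finset.range (t + 1)) (fun n => |r n|) ⟨0, Finset.mem_range.2 (Nat.succ_pos t)⟩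
  have hi₀t : i₀ ≤ t := by have := Finset.mem_range.1 hi₀; omega
  have hmax' : ∀ n, n ≤ t → |r n| ≤ |r i₀| := fun n hn => hmax n (Finset.mem_range.2 (Nat.lt_succ_of_le hn))
  have hrpos : 0 < |r i₀| := lt_of_lt_of_le (by rw [hr0, abs_one]; exact one_pos) (hmax' 0 (Nat.zero_le _))
  refine ⟨i₀, hi₀t, ?_⟩
  rcases Nat.eq_zero_or_pos i₀ with h0 | hpos
  · -- `i₀ = 0`: `ξ − a_0 = q_1(ξ)`
    subst h0
    have h1 : ξ - a 0 = (q 1).eval ξ := by rw [hq1, eval_sub, eval_X, eval_C]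
    rw [if_neg (by omega), zero_add, h1, habs 1, show (1 : ℕ) = 0 + 1 from rfl, hCsucc 0, hC0, one_mul]
    by_cases ht : 0 + 1 ≤ t
    · rw [if_pos ht]
      have h := hmax' (0 + 1) ht
      rw [hr0, abs_one] at h
      calc |r (0 + 1)| * c (0 + 1) ≤ 1 * c (0 + 1) := mul_le_mul_of_nonneg_right h (hc (0 + 1)).le
        _ = c (0 + 1) := one_mul _
    · rw [if_neg ht]
      have ht0 : t = 0 := by omega
      subst ht0
      have : r (0 + 1) = 0 := by rw [hr]; simp only; rw [hξ, zero_div]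
      rw [this, abs_zero, zero_mul]
  · -- `i₀ = j + 1`: the three-term relation at `ξ`
    obtain ⟨j, rfl⟩ : ∃ j, i₀ = j + 1 := ⟨i₀ - 1, by omega⟩
    rw [if_pos (by omega)]
    have hrel : (ξ - a (j + 1)) * (q (j + 1)).eval ξ = (q (j + 2)).eval ξ + b (j + 1) * (q j).eval ξ := by
      have h := congrArg (eval ξ) (hrec j)
      simp only [eval_sub, eval_mul, eval_X, eval_C] at h
      linarith
    -- absolute values
    have hineq : |ξ - a (j + 1)| * (|r (j + 1)| * Cn (j + 1)) ≤ |r (j + 2)| * Cn (j + 2) + b (j + 1) * (|r j| * Cn j) := by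
      rw [← habs, ← habs, ← habs, ← abs_mul, hrel, ← abs_of_nonneg (hb (j + 1)), ← abs_mul, abs_of_nonneg (hb (j + 1))]
      exact abs_add_le _ _
    -- the upper neighbour
    have hup : |r (j + 2)| * Cn (j + 2) ≤ (if j + 1 + 1 ≤ t then c (j + 1 + 1) else 0) * (|r (j + 1)| * Cn (j + 1)) := by
      by_cases h2 : j + 1 + 1 ≤ t
      · rw [if_pos h2, show j + 2 = j + 1 + 1 by ring, hCsucc (j + 1)]
        have := hmax' (j + 1 + 1) h2
        calc |r (j + 1 + 1)| * (Cn (j + 1) * c (j + 1 + 1)) ≤ |r (j + 1)| * (Cn (j + 1) * c (j + 1 + 1)) :=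
              mul_le_mul_of_nonneg_right this (mul_pos (hCpos (j + 1)) (hc (j + 1 + 1))).le
          _ = c (j + 1 + 1) * (|r (j + 1)| * Cn (j + 1)) := by ring
      · rw [if_neg h2, zero_mul]
        have ht : j + 2 = t + 1 := by omega
        rw [ht, hr]
        simp only
        rw [hξ, zero_div, abs_zero, zero_mul]
    -- the lower neighbour
    have hlow : b (j + 1) * (|r j| * Cn j) ≤ c (j + 1) * (|r (j + 1)| * Cn (j + 1)) := by
      rw [hCsucc j]
      have h1 := hmax' j (by omega)
      have h2 := hbc (j + 1)
      have h3 := hCpos j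
      have h4 := hc (j + 1)
      have h5 : 0 ≤ |r j| := abs_nonneg _
      calc b (j + 1) * (|r j| * Cn j) ≤ c (j + 1) ^ 2 * (|r (j + 1)| * Cn j) :=
            mul_le_mul h2 (mul_le_mul_of_nonneg_right h1 h3.le) (mul_nonneg h5 h3.le) (sq_nonneg _)
        _ = c (j + 1) * (|r (j + 1)| * (Cn j * c (j + 1))) := by ring
    have hkey : |ξ - a (j + 1)| * (|r (j + 1)| * Cn (j + 1)) ≤ (c (j + 1) + (if j + 1 + 1 ≤ t then c (j + 1 + 1) else 0)) * (|r (j + 1)| * Cn (j + 1)) := by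
      rw [add_mul]; linarith
    exact le_of_mul_le_mul_right hkey (mul_pos hrpos (hCpos _))

/-- **Cruder form: `∃ i ≤ t, |ξ − a_i| ≤ c_i + c_{i+1}`.** [Gerschgorin 1931; this file, §1120] -/
theorem zero_mem_gershgorin_union' {q : ℕ → ℝ[X]} {a b : ℕ → ℝ} (hq0 : q 0 = 1) (hq1 : q 1 = Polynomial.X - C (a 0))
    (hrec : ∀ n, q (n + 2) = (Polynomial.X - C (a (n + 1))) * q (n + 1) - C (b (n + 1)) * q n) (hb : ∀ j, 0 ≤ b j)
    {c : ℕ → ℝ} (hc : ∀ j, 0 < c j) (hbc : ∀ j, b j ≤ c j ^ 2) (t : ℕ) {ξ : ℝ} (hξ : (q (t + 1)).eval ξ = 0) :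
    ∃ i, i ≤ t ∧ |ξ - a i| ≤ c i + c (i + 1) := by
  obtain ⟨i, hi, h⟩ := zero_mem_gershgorin_union hq0 hq1 hrec hb hc hbc t hξ
  refine ⟨i, hi, h.trans (add_le_add ?_ ?_)⟩
  · split_ifs
    · exact le_rfl
    · exact (hc i).le
  · split_ifs
    · exact le_rfl
    · exact (hc (i + 1)).le

end Summit.Ventures.HSemireg.Wedge.HankelOuter
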